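import Literature.Analysis.PDE.WaveSliceEnergyIdentity
import Literature.Analysis.Convolution.ScaledMollifierL2
import Literature.Analysis.FluidPDE.EnergyToolkit
import HarnessLib

/-!
# The uniform energy inequality for the regularised frozen-time wave system

Analysis/PDE support file (everything proved, no named facts). It is the key estimate,
uniform in the regularisation parameter `ε ∈ (0, 1]`, of the existence proof for linear
second-order hyperbolic equations by the regularised evolution (S. Alinhac, *Hyperbolic Partial
Differential Equations* (2009), Thm. 7.11, proof, Step 2 (c): "The essential point is this: We
can obtain for the system … governing `v_α` an energy inequality with fixed constants independent
of `ε`", the `L²` pairing being rearranged with the self-adjointness of `C_ε` and the commutation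
lemma). In the variables `(u, X)` of `WaveSliceEnergyIdentity` (frozen coefficients
`c : SliceCoeff`, cut-off `ψ ∈ C_c^∞`) the regularised right-hand side is

  `F₁ = J_ε (ψ · vel c (J_ε u) (J_ε X))`,  `F₂ = J_ε (ψ · divFlux c (J_ε u) (J_ε X))`

(`J_ε = mollify ε` of `Convolution/ScaledMollifier`: the doubly regularised, cut-off operator
`Y ↦ J_ε(ψ 𝒜 (J_ε Y))`, a bounded operator on bounded continuous functions), and the main result
`integral_epair_regularised_le` is

  `∫ epair c u X F₁ F₂ ≤ C⋆ · ∫ (X² + ∑ᵢ (∂ᵢu)²)`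

for all smooth compactly supported `u, X`, all `ε ∈ (0, 1]`, with
`C⋆ = (408 + 270 L (1 + K)) M⁵ (1 + a₀⁻¹)²` depending only on bounds `M` for `ψ`, the
coefficients and their first derivatives on `supp ψ`, the lower bound `a₀` of `a` there, a
Lipschitz constant `L` of the energy form `𝔅` on the `2`-neighbourhood of `supp ψ`, and the
gradient mass `K` of the mollifier. Proof (Alinhac, loc. cit.): move one `J_ε` to the other
factor by adjointness (`integral_mul_mollify_comm`), commute `J_ε` with `∂ⱼ`, commute `J_ε` past
`𝔅ᵢⱼ` at the price of the commutator `[J_ε, 𝔅ᵢⱼ] ∂ᵢu` — of size `2εL ‖∂ᵢu‖₂` in `L²` on `supp ψ`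
(`integral_indicator_sq_commutator_le`, the localised form of `ScaledMollifierL2`) and paired
with `∂ⱼ(ψ V)`, of size `≲ ε⁻¹` (`integral_sq_norm_fderiv_mollify_le`) — and apply the weighted
energy identity of `WaveSliceEnergyIdentity` to the mollified pair `(J_ε u, J_ε X)`, for which
every `L²` quantity is bounded by the corresponding one of `(u, X)` (`integral_sq_mollify_le`).

## References

* S. Alinhac, *Hyperbolic Partial Differential Equations*, Springer (2009), §7.6, proof of
  Thm. 7.11, Step 2 (c); Lemma 7.12. [`AlinhacHPDE2009`]
* L. Hörmander, *Lectures on Nonlinear Hyperbolic Differential Equations* (1997), §6.3,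
  Lemma 6.3.3. [`Hormander1997`]
-/

noncomputable section

open MeasureTheory Set Function Filter Finset Metric
open scoped BigOperators ContDiff Topology Convolution

namespace Literature.Analysis.PDE

open Literature.Analysis.FluidPDE Literature.Analysis.Convolution

/-- Euclidean `3`-space (local notation). -/
local notation "𝔼" => EuclideanSpace ℝ (Fin 3)

/-! ### `L²` tools for continuous compactly supported real functions -/

section L2Tools

variable {f g : 𝔼 → ℝ}

/-- A continuous compactly supported function is in `L²`. [folklore] -/
theorem memLp_two_of_cc (hf : Continuous f) (hfc : HasCompactSupport f) : MemLp f 2 volume :=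
  hf.memLp_of_hasCompactSupport hfc

/-- The square of a continuous compactly supported function is integrable. [folklore] -/
theorem integrable_sq_of_cc (hf : Continuous f) (hfc : HasCompactSupport f) :
    Integrable (fun x => f x ^ 2) :=
  (memLp_two_of_cc hf hfc).integrable_sq

/-- **Cauchy–Schwarz** in real form for continuous compactly supported functions:
`∫ f g ≤ √(∫ f²) √(∫ g²)`. [folklore] -/
theorem integral_mul_le_sqrt_cc (hf : Continuous f) (hfc : HasCompactSupport f) (hg : Continuous g)
    (hgc : HasCompactSupport g) :
    ∫ x, f x * g x ≤ Real.sqrt (∫ x, f x ^ 2) * Real.sqrt (∫ x, g x ^ 2) :=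
  integral_mul_le_sqrt_mul_sqrt_of_memLp (memLp_two_of_cc hf hfc) (memLp_two_of_cc hg hgc)

/-- **Cauchy–Schwarz with a measurable `L²` first factor** (used for the indicator-localised
commutator): `∫ f g ≤ √(∫ f²) √(∫ g²)` for `f ∈ L²` and `g` continuous compactly supported.
[folklore] -/
theorem integral_mul_le_sqrt_of_memLp_cc (hf : MemLp f 2 volume) (hg : Continuous g)
    (hgc : HasCompactSupport g) :
    ∫ x, f x * g x ≤ Real.sqrt (∫ x, f x ^ 2) * Real.sqrt (∫ x, g x ^ 2) :=
  integral_mul_le_sqrt_mul_sqrt_of_memLp hf (memLp_two_of_cc hg hgc)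

/-- Comparison of integrals of squares under a pointwise bound `|f| ≤ C |g|` (`C ≥ 0`), `f`
measurable, `g ∈ L²`: `∫ f² ≤ C² ∫ g²`. [folklore] -/
theorem integral_sq_le_of_abs_le {C : ℝ} (hfm : AEStronglyMeasurable f volume)
    (hg : Integrable (fun x => g x ^ 2)) (h : ∀ x, |f x| ≤ C * |g x|) :
    Integrable (fun x => f x ^ 2) ∧ ∫ x, f x ^ 2 ≤ C ^ 2 * ∫ x, g x ^ 2 := by
  have hpt : ∀ x, f x ^ 2 ≤ C ^ 2 * g x ^ 2 := fun x => by
    rw [← sq_abs (f x), ← sq_abs (g x), ← mul_pow]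
    exact pow_le_pow_left₀ (abs_nonneg _) (h x) 2
  have hint : Integrable (fun x => f x ^ 2) :=
    (hg.const_mul (C ^ 2)).mono' (hfm.pow 2) (ae_of_all _ fun x => by
      rw [Real.norm_of_nonneg (sq_nonneg _)]; exact hpt x)
  refine ⟨hint, ?_⟩
  calc ∫ x, f x ^ 2 ≤ ∫ x, C ^ 2 * g x ^ 2 := integral_mono hint (hg.const_mul _) hpt
    _ = C ^ 2 * ∫ x, g x ^ 2 := integral_const_mul _ _

/-- `√(∫ f²)` is monotone under `∫ f² ≤ ∫ g²` (trivial wrapper fixing the shape used below).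
[folklore] -/
theorem sqrt_integral_sq_le_of_le {a b : ℝ} (h : a ≤ b) : Real.sqrt a ≤ Real.sqrt b :=
  Real.sqrt_le_sqrt h

end L2Tools

/-! ### The localised commutator estimate -/

/-- **Localised commutator estimate**: if `|a y − a x| ≤ L ‖x − y‖` for all `x ∈ S` and
`‖x − y‖ < 2ε`, then the commutator `[J_ε, a] f = J_ε(a f) − a J_ε f`, restricted to the
measurable set `S`, satisfies `∫_S ([J_ε, a] f)² ≤ (2εL)² ∫ f²` for continuous compactly supported
`f` (domination of `𝟙_S [J_ε, a] f` by the convolution of `|f|` with `2εL ρ_ε`, then Jensen;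
Alinhac 2009, Lemma 7.12, zeroth-order part). [cite: AlinhacHPDE2009, Lemma 7.12] -/
theorem integral_indicator_sq_commutator_le {ε : ℝ} (hε : 0 < ε) {a : 𝔼 → ℝ} (ha : Continuous a)
    {f : 𝔼 → ℝ} (hf : Continuous f) (hfc : HasCompactSupport f) {S : Set 𝔼}
    (hS : MeasurableSet S) {L : ℝ} (hL0 : 0 ≤ L)
    (hL : ∀ x ∈ S, ∀ y, ‖x - y‖ < 2 * ε → |a y - a x| ≤ L * ‖x - y‖) :
    Integrable (fun x => (S.indicator
        (fun x => mollify ε (fun y => a y * f y) x - a x * mollify ε f x) x) ^ 2) ∧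
      ∫ x, (S.indicator (fun x => mollify ε (fun y => a y * f y) x - a x * mollify ε f x) x) ^ 2 ≤
        (2 * ε * L) ^ 2 * ∫ y, f y ^ 2 := by
  have hfl : LocallyIntegrable f volume := hf.locallyIntegrable
  have haf : LocallyIntegrable (fun y => a y • f y) volume := (ha.smul hf).locallyIntegrable
  have hf2 : MemLp f 2 volume := memLp_two_of_cc hf hfc
  -- the commutator and its measurability
  set Φ : 𝔼 → ℝ := fun x => mollify ε (fun y => a y * f y) x - a x * mollify ε f x with hΦ
  have hΦ' : Φ = fun x => mollify ε (fun y => a y • f y) x - a x • mollify ε f x := by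
    funext x; simp only [hΦ, smul_eq_mul]
  have hΦc : Continuous Φ := by
    rw [hΦ']
    exact (continuous_mollify ε haf).sub (ha.smul (continuous_mollify ε hfl))
  have hgm : AEStronglyMeasurable (S.indicator Φ) volume := hΦc.aestronglyMeasurable.indicator hS
  -- the dominating kernel `2εL ρ_ε`
  set k : 𝔼 → ℝ := fun z => (2 * ε * L) * mollifier ε z with hk
  have hkc' : Continuous k := continuous_const.mul (continuous_mollifier ε)
  have hks : HasCompactSupport k := (hasCompactSupport_mollifier ε).mul_left
  have hk0 : ∀ z, 0 ≤ k z := fun z => mul_nonneg (by positivity) (mollifier_nonneg ε z)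
  have hkint : ∫ z, k z = 2 * ε * L := by
    rw [hk]; simp only
    rw [integral_const_mul, integral_mollifier, mul_one]
  -- pointwise domination of the localised commutator
  have hdom : ∀ x, ‖S.indicator Φ x‖ ≤ (k ⋆[ContinuousLinearMap.lsmul ℝ ℝ, volume] fun y => ‖f y‖) x := by
    intro x
    have hconv_nonneg : 0 ≤ (k ⋆[ContinuousLinearMap.lsmul ℝ ℝ, volume] fun y => ‖f y‖) x := by
      rw [convolution_lsmul_swap]
      exact integral_nonneg fun y => by
        simp only [smul_eq_mul]; exact mul_nonneg (hk0 _) (norm_nonneg _)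
    by_cases hx : x ∈ S
    · have hΦx : Φ x = mollify ε (fun y => a y • f y) x - a x • mollify ε f x := by
        rw [hΦ']
      rw [Set.indicator_of_mem hx, hΦx, mollify_smul_sub_smul_mollify ε hfl haf x,
        convolution_lsmul_swap]
      have hρx : Continuous fun y : 𝔼 => k (x - y) := hkc'.comp (continuous_const.sub continuous_id)
      have hρxc : HasCompactSupport fun y : 𝔼 => k (x - y) :=
        hks.comp_homeomorph (Homeomorph.subLeft x)
      have hfln : LocallyIntegrable (fun y => ‖f y‖) volume :=
        hfl.mono hfl.aestronglyMeasurable.norm (ae_of_all _ fun y => by simp)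
      have hint : Integrable (fun y => k (x - y) * ‖f y‖) volume :=
        hfln.integrable_smul_left_of_hasCompactSupport hρx hρxc
      calc ‖∫ y, (mollifier ε (x - y) * (a y - a x)) • f y‖
          ≤ ∫ y, k (x - y) * ‖f y‖ := by
            refine norm_integral_le_of_norm_le hint (ae_of_all _ fun y => ?_)
            rw [norm_smul, norm_mul, Real.norm_of_nonneg (mollifier_nonneg ε _)]
            refine mul_le_mul_of_nonneg_right ?_ (norm_nonneg _)
            by_cases hρ0 : mollifier ε (x - y) = 0
            · simp [hρ0, hk]
            · have hxy : ‖x - y‖ < 2 * ε := by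
                have hmem : x - y ∈ Function.support (mollifier ε : 𝔼 → ℝ) := hρ0
                rw [support_mollifier hε, mem_ball_zero_iff] at hmem
                exact hmem
              have h1 := hL x hx y hxy
              rw [hk, Real.norm_eq_abs]
              calc mollifier ε (x - y) * |a y - a x|
                  ≤ mollifier ε (x - y) * (L * (2 * ε)) := by
                    refine mul_le_mul_of_nonneg_left (h1.trans ?_) (mollifier_nonneg ε _)
                    exact mul_le_mul_of_nonneg_left hxy.le hL0
                _ = 2 * ε * L * mollifier ε (x - y) := by ring
        _ = ∫ y, k (x - y) • ‖f y‖ := by simp only [smul_eq_mul]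
    · rw [Set.indicator_of_notMem hx, norm_zero]
      exact hconv_nonneg
  obtain ⟨hi, hle⟩ := integral_sq_norm_le_of_norm_le_convolution hkc' hks hk0 hf2 hgm hdom
  rw [hkint] at hle
  refine ⟨?_, ?_⟩
  · refine hi.congr (ae_of_all _ fun x => ?_)
    simp only [Real.norm_eq_abs, sq_abs]
  · have h1 : ∫ x, (S.indicator Φ x) ^ 2 = ∫ x, ‖S.indicator Φ x‖ ^ 2 :=
      integral_congr_ae (ae_of_all _ fun x => by simp only [Real.norm_eq_abs, sq_abs])
    have h2 : ∫ y, f y ^ 2 = ∫ y, ‖f y‖ ^ 2 :=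
      integral_congr_ae (ae_of_all _ fun y => by simp only [Real.norm_eq_abs, sq_abs])
    rw [h1, h2]
    exact hle

/-! ### Mollified functions: smoothness, derivatives, `L²` bounds -/

section Mollified

variable {f : 𝔼 → ℝ}

/-- `J_ε f` is smooth for continuous `f`. [folklore] -/
theorem contDiff_mollify_of_continuous (ε : ℝ) (hf : Continuous f) : ContDiff ℝ ∞ (mollify ε f) :=
  contDiff_mollify ε hf.locallyIntegrable

/-- **`∂ᵢ J_ε f = J_ε ∂ᵢ f`** for `f ∈ C^∞_c` (coordinate form of `fderiv_mollify_apply_eq_mollify`).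
[cite: AlinhacHPDE2009, Thm. 7.11 proof Step 1] -/
theorem pderiv_mollify_eq (ε : ℝ) (hf : ContDiff ℝ ∞ f) (hfc : HasCompactSupport f) (i : Fin 3) :
    pderiv i (mollify ε f) = mollify ε (pderiv i f) := by
  funext x
  rw [pderiv_apply, fderiv_mollify_apply_eq_mollify ε (hf.of_le (by simp)) hfc x (stdVec i)]
  rfl

/-- `∫ (J_ε f)² ≤ ∫ f²` for continuous compactly supported `f`. [cite: AlinhacHPDE2009, Thm. 7.11 proof Step 1] -/
theorem integral_sq_mollify_le_cc (ε : ℝ) (hf : Continuous f) (hfc : HasCompactSupport f) :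
    ∫ x, mollify ε f x ^ 2 ≤ ∫ x, f x ^ 2 :=
  integral_sq_mollify_le ε (memLp_two_of_cc hf hfc)

/-- **`∫ (∂ⱼ J_ε f)² ≤ (ε⁻¹K)² ∫ f²`** for continuous compactly supported `f`
(`K = mollifierGradMass`). [cite: AlinhacHPDE2009, Thm. 7.11 proof Step 2 (a)] -/
theorem integral_sq_pderiv_mollify_le {ε : ℝ} (hε : 0 < ε) (hf : Continuous f)
    (hfc : HasCompactSupport f) (j : Fin 3) :
    Integrable (fun x => pderiv j (mollify ε f) x ^ 2) ∧
      ∫ x, pderiv j (mollify ε f) x ^ 2 ≤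
        (ε⁻¹ * mollifierGradMass 𝔼) ^ 2 * ∫ x, f x ^ 2 := by
  obtain ⟨hi, hle⟩ := integral_sq_norm_fderiv_mollify_le hε (memLp_two_of_cc hf hfc) (stdVec j)
  have hn : ‖(stdVec j : 𝔼)‖ = 1 := by simp [stdVec]
  rw [hn, mul_one] at hle
  refine ⟨hi.congr (ae_of_all _ fun x => by simp only [pderiv_apply, Real.norm_eq_abs, sq_abs]), ?_⟩
  have h1 : ∫ x, pderiv j (mollify ε f) x ^ 2 = ∫ x, ‖fderiv ℝ (mollify ε f) x (stdVec j)‖ ^ 2 :=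
    integral_congr_ae (ae_of_all _ fun x => by simp only [pderiv_apply, Real.norm_eq_abs, sq_abs])
  have h2 : ∫ x, f x ^ 2 = ∫ x, ‖f x‖ ^ 2 :=
    integral_congr_ae (ae_of_all _ fun x => by simp only [Real.norm_eq_abs, sq_abs])
  rw [h1, h2]
  exact hle

end Mollified

/-! ### Pointwise bounds under coefficient bounds -/

/-- **Coefficient bounds at a point**: the weight `ψ`, the coefficients `a, b, g` of `c` and all
their first coordinate derivatives are bounded by `M` at `x`, and `a x ≥ a₀`. [folklore] -/
structure CoeffBoundAt (c : SliceCoeff) (ψ : 𝔼 → ℝ) (M a₀ : ℝ) (x : 𝔼) : Prop where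
  /-- `|ψ x| ≤ M` -/
  ψ_le : |ψ x| ≤ M
  /-- `|∂ᵢψ x| ≤ M` -/
  dψ_le : ∀ i, |pderiv i ψ x| ≤ M
  /-- `a₀ ≤ a x` -/
  a₀_le : a₀ ≤ c.a x
  /-- `|a x| ≤ M` -/
  a_le : |c.a x| ≤ M
  /-- `|∂ᵢa x| ≤ M` -/
  da_le : ∀ i, |pderiv i c.a x| ≤ M
  /-- `|bᵢ x| ≤ M` -/
  b_le : ∀ i, |c.b i x| ≤ M
  /-- `|∂ᵢbₖ x| ≤ M` -/
  db_le : ∀ i k, |pderiv i (c.b k) x| ≤ M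
  /-- `|gᵢⱼ x| ≤ M` -/
  g_le : ∀ i j, |c.g i j x| ≤ M
  /-- `|∂ₖgᵢⱼ x| ≤ M` -/
  dg_le : ∀ k i j, |pderiv k (c.g i j) x| ≤ M

namespace SliceCoeff

variable (c : SliceCoeff)

/-- The `ℓ¹` size `r = |X x| + ∑ᵢ |∂ᵢu x|` of a pair at a point. [folklore] -/
def psize (u X : 𝔼 → ℝ) (x : 𝔼) : ℝ := |X x| + ∑ i, |pderiv i u x|

/-- `psize ≥ 0`. [folklore] -/
theorem psize_nonneg (u X : 𝔼 → ℝ) (x : 𝔼) : 0 ≤ psize u X x :=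
  add_nonneg (abs_nonneg _) (Finset.sum_nonneg fun _ _ => abs_nonneg _)

/-- `psize² ≤ 4 (X² + ∑ (∂ᵢu)²)`. [folklore] -/
theorem psize_sq_le (u X : 𝔼 → ℝ) (x : 𝔼) :
    psize u X x ^ 2 ≤ 4 * (X x ^ 2 + ∑ i, pderiv i u x ^ 2) := by
  set p : Fin 3 → ℝ := fun i => pderiv i u x with hp
  have hexp : psize u X x = |X x| + |p 0| + |p 1| + |p 2| := by
    rw [psize, Fin.sum_univ_three]; ring
  have h4 : (|X x| + |p 0| + |p 1| + |p 2|) ^ 2 ≤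
      4 * (|X x| ^ 2 + |p 0| ^ 2 + |p 1| ^ 2 + |p 2| ^ 2) := by
    nlinarith [sq_nonneg (|X x| - |p 0|), sq_nonneg (|X x| - |p 1|), sq_nonneg (|X x| - |p 2|),
      sq_nonneg (|p 0| - |p 1|), sq_nonneg (|p 0| - |p 2|), sq_nonneg (|p 1| - |p 2|)]
  rw [← hexp, sq_abs, sq_abs, sq_abs, sq_abs] at h4
  simpa [Fin.sum_univ_three, hp, add_assoc] using h4

variable {c}

/-- **`|S| ≤ M r`** (`S = bgrad u`). [folklore] -/
theorem abs_bgrad_le {ψ : 𝔼 → ℝ} {M a₀ : ℝ} {x : 𝔼} (hb : CoeffBoundAt c ψ M a₀ x) (hM : 0 ≤ M)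
    (u X : 𝔼 → ℝ) : |c.bgrad u x| ≤ M * psize u X x := by
  rw [bgrad_apply]
  calc |∑ i, c.b i x * pderiv i u x| ≤ ∑ i, |c.b i x * pderiv i u x| := Finset.abs_sum_le_sum_abs _ _
    _ ≤ ∑ i, M * |pderiv i u x| := Finset.sum_le_sum fun i _ => by
        rw [abs_mul]; exact mul_le_mul (hb.b_le i) le_rfl (abs_nonneg _) hM
    _ = M * ∑ i, |pderiv i u x| := by rw [Finset.mul_sum]
    _ ≤ M * psize u X x :=
        mul_le_mul_of_nonneg_left (le_add_of_nonneg_left (abs_nonneg _)) hM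

/-- **`|V| ≤ 2 M (1 + a₀⁻¹) r`** (`V = vel u X`). [folklore] -/
theorem abs_vel_le {ψ : 𝔼 → ℝ} {M a₀ : ℝ} {x : 𝔼} (hb : CoeffBoundAt c ψ M a₀ x) (hM : 1 ≤ M)
    (ha₀ : 0 < a₀) (u X : 𝔼 → ℝ) :
    |c.vel u X x| ≤ 2 * M * (1 + a₀⁻¹) * psize u X x := by
  have hM0 : 0 ≤ M := zero_le_one.trans hM
  have hr0 := psize_nonneg u X x
  have hax0 : 0 < c.a x := c.a_pos x
  have hXr : |X x| ≤ psize u X x :=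
    le_add_of_nonneg_right (Finset.sum_nonneg fun _ _ => abs_nonneg _)
  have h1 : |c.bgrad u x - X x| ≤ 2 * M * psize u X x := by
    calc |c.bgrad u x - X x| ≤ |c.bgrad u x| + |X x| := abs_sub _ _
      _ ≤ M * psize u X x + psize u X x := add_le_add (abs_bgrad_le hb hM0 u X) hXr
      _ ≤ 2 * M * psize u X x := by nlinarith
  have h2M : 0 ≤ 2 * M * psize u X x := by positivity
  unfold vel
  rw [abs_div, abs_of_pos hax0]
  calc |c.bgrad u x - X x| / c.a x ≤ 2 * M * psize u X x / c.a x :=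
        div_le_div_of_nonneg_right h1 hax0.le
    _ ≤ 2 * M * psize u X x / a₀ := div_le_div_of_nonneg_left h2M ha₀ hb.a₀_le
    _ = 2 * M * psize u X x * a₀⁻¹ := div_eq_mul_inv _ _
    _ ≤ 2 * M * psize u X x * (1 + a₀⁻¹) := by
        refine mul_le_mul_of_nonneg_left ?_ h2M
        linarith
    _ = 2 * M * (1 + a₀⁻¹) * psize u X x := by ring

/-- `|𝔅ᵢⱼ| ≤ 2 M²`. [folklore] -/
theorem abs_bform_le {ψ : 𝔼 → ℝ} {M a₀ : ℝ} {x : 𝔼} (hb : CoeffBoundAt c ψ M a₀ x) (hM : 0 ≤ M)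
    (i j : Fin 3) : |c.bform i j x| ≤ 2 * M ^ 2 := by
  rw [bform_apply]
  calc |c.a x * c.g i j x + c.b i x * c.b j x| ≤ |c.a x * c.g i j x| + |c.b i x * c.b j x| :=
        abs_add_le _ _
    _ ≤ M * M + M * M := by
        rw [abs_mul, abs_mul]
        exact add_le_add (mul_le_mul hb.a_le (hb.g_le i j) (abs_nonneg _) hM)
          (mul_le_mul (hb.b_le i) (hb.b_le j) (abs_nonneg _) hM)
    _ = 2 * M ^ 2 := by ring

/-- **The derivative of the velocity**: `a ∂ⱼV = ∂ⱼS − ∂ⱼX − (∂ⱼa) V` (product rule applied to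
`a V = S − X`). [folklore] -/
theorem a_mul_pderiv_vel (c : SliceCoeff) {u X : 𝔼 → ℝ} (hu : ContDiff ℝ ∞ u)
    (hX : ContDiff ℝ ∞ X) (j : Fin 3) (x : 𝔼) :
    c.a x * pderiv j (c.vel u X) x =
      pderiv j (c.bgrad u) x - pderiv j X x - pderiv j c.a x * c.vel u X x := by
  have hinf : (∞ : WithTop ℕ∞) ≠ 0 := by simp
  have da : Differentiable ℝ c.a := c.contDiff_a.differentiable hinf
  have dV : Differentiable ℝ (c.vel u X) := (contDiff_vel c hu hX).differentiable hinf
  have dS : Differentiable ℝ (c.bgrad u) := (contDiff_bgrad c hu).differentiable hinf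
  have dXd : Differentiable ℝ X := hX.differentiable hinf
  -- `a V = S − X` as functions
  have hprod : (fun y => c.a y * c.vel u X y) = fun y => c.bgrad u y - X y := by
    funext y
    unfold vel
    field_simp [a_ne_zero c y]
  have h := congrFun (pderiv_mul da dV j) x
  rw [hprod, pderiv_sub dS dXd] at h
  simp only at h
  linarith

/-- `|∂ⱼS| ≤ M r + M ∑ₖ |∂ⱼ∂ₖu|`. [folklore] -/
theorem abs_pderiv_bgrad_le {ψ : 𝔼 → ℝ} {M a₀ : ℝ} {x : 𝔼} (hb : CoeffBoundAt c ψ M a₀ x)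
    (hM : 0 ≤ M) {u : 𝔼 → ℝ} (hu : ContDiff ℝ ∞ u) (X : 𝔼 → ℝ) (j : Fin 3) :
    |pderiv j (c.bgrad u) x| ≤
      M * psize u X x + M * ∑ k, |pderiv j (pderiv k u) x| := by
  have hinf : (∞ : WithTop ℕ∞) ≠ 0 := by simp
  have db : ∀ i, Differentiable ℝ (c.b i) := fun i => (c.contDiff_b i).differentiable hinf
  have dp : ∀ i, Differentiable ℝ (pderiv i u) := fun i =>
    (contDiff_pderiv hu i).differentiable hinf
  have h : c.bgrad u = fun z => ∑ k, c.b k z * pderiv k u z := rfl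
  rw [h, pderiv_sum (f := fun k z => c.b k z * pderiv k u z) univ
    (fun k _ => (db k).fun_mul (dp k))]
  simp only [pderiv_mul (db _) (dp _)]
  calc |∑ k, (pderiv j (c.b k) x * pderiv k u x + c.b k x * pderiv j (pderiv k u) x)|
      ≤ ∑ k, |pderiv j (c.b k) x * pderiv k u x + c.b k x * pderiv j (pderiv k u) x| :=
        Finset.abs_sum_le_sum_abs _ _
    _ ≤ ∑ k, (M * |pderiv k u x| + M * |pderiv j (pderiv k u) x|) :=
        Finset.sum_le_sum fun k _ => by
          calc _ ≤ |pderiv j (c.b k) x * pderiv k u x| + |c.b k x * pderiv j (pderiv k u) x| :=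
                abs_add_le _ _
            _ ≤ M * |pderiv k u x| + M * |pderiv j (pderiv k u) x| := by
                rw [abs_mul, abs_mul]
                exact add_le_add (mul_le_mul (hb.db_le j k) le_rfl (abs_nonneg _) hM)
                  (mul_le_mul (hb.b_le k) le_rfl (abs_nonneg _) hM)
    _ = M * ∑ k, |pderiv k u x| + M * ∑ k, |pderiv j (pderiv k u) x| := by
        rw [Finset.sum_add_distrib, Finset.mul_sum, Finset.mul_sum]
    _ ≤ M * psize u X x + M * ∑ k, |pderiv j (pderiv k u) x| := by
        refine add_le_add (mul_le_mul_of_nonneg_left ?_ hM) le_rfl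
        exact le_add_of_nonneg_left (abs_nonneg _)

/-- **`|∂ⱼV| ≤ 3M²A² r + M A ∑ₖ |∂ⱼ∂ₖu| + A |∂ⱼX|`**, `A = 1 + a₀⁻¹`. [folklore] -/
theorem abs_pderiv_vel_le {ψ : 𝔼 → ℝ} {M a₀ : ℝ} {x : 𝔼} (hb : CoeffBoundAt c ψ M a₀ x)
    (hM : 1 ≤ M) (ha₀ : 0 < a₀) {u X : 𝔼 → ℝ} (hu : ContDiff ℝ ∞ u) (hX : ContDiff ℝ ∞ X)
    (j : Fin 3) :
    |pderiv j (c.vel u X) x| ≤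
      3 * M ^ 2 * (1 + a₀⁻¹) ^ 2 * psize u X x +
        M * (1 + a₀⁻¹) * (∑ k, |pderiv j (pderiv k u) x|) + (1 + a₀⁻¹) * |pderiv j X x| := by
  set A : ℝ := 1 + a₀⁻¹ with hA
  set r := psize u X x with hr
  set q := ∑ k, |pderiv j (pderiv k u) x| with hq
  have hM0 : 0 ≤ M := zero_le_one.trans hM
  have ha₀inv : 0 < a₀⁻¹ := inv_pos.2 ha₀
  have hA1 : 1 ≤ A := by rw [hA]; linarith
  have hA0 : 0 ≤ A := zero_le_one.trans hA1
  have hr0 : 0 ≤ r := psize_nonneg u X x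
  have hq0 : 0 ≤ q := Finset.sum_nonneg fun _ _ => abs_nonneg _
  have hax0 : 0 < c.a x := c.a_pos x
  have hV := abs_vel_le hb hM ha₀ u X
  -- `|a ∂ⱼV| ≤ (M r + M q) + |∂ⱼX| + M |V|`
  have hnum : |c.a x * pderiv j (c.vel u X) x| ≤ M * r + M * q + |pderiv j X x| +
      M * (2 * M * A * r) := by
    rw [a_mul_pderiv_vel c hu hX j x]
    calc |pderiv j (c.bgrad u) x - pderiv j X x - pderiv j c.a x * c.vel u X x|
        ≤ |pderiv j (c.bgrad u) x - pderiv j X x| + |pderiv j c.a x * c.vel u X x| := abs_sub _ _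
      _ ≤ (|pderiv j (c.bgrad u) x| + |pderiv j X x|) + |pderiv j c.a x| * |c.vel u X x| := by
          rw [abs_mul]; exact add_le_add (abs_sub _ _) le_rfl
      _ ≤ (M * r + M * q + |pderiv j X x|) + M * (2 * M * A * r) :=
          add_le_add (add_le_add (abs_pderiv_bgrad_le hb hM0 hu X j) le_rfl)
            (mul_le_mul (hb.da_le j) hV (abs_nonneg _) hM0)
      _ = M * r + M * q + |pderiv j X x| + M * (2 * M * A * r) := by ring
  -- divide by `a x ≥ a₀`
  have hdiv : |pderiv j (c.vel u X) x| ≤ (M * r + M * q + |pderiv j X x| +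
      M * (2 * M * A * r)) * a₀⁻¹ := by
    have h1 : |pderiv j (c.vel u X) x| = |c.a x * pderiv j (c.vel u X) x| / c.a x := by
      rw [abs_mul, abs_of_pos hax0, mul_div_cancel_left₀ _ hax0.ne']
    rw [h1]
    have hn0 : 0 ≤ M * r + M * q + |pderiv j X x| + M * (2 * M * A * r) := by positivity
    calc |c.a x * pderiv j (c.vel u X) x| / c.a x
        ≤ (M * r + M * q + |pderiv j X x| + M * (2 * M * A * r)) / c.a x :=
          div_le_div_of_nonneg_right hnum hax0.le
      _ ≤ (M * r + M * q + |pderiv j X x| + M * (2 * M * A * r)) / a₀ :=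
          div_le_div_of_nonneg_left hn0 ha₀ hb.a₀_le
      _ = _ := div_eq_mul_inv _ _
  have hinvA : a₀⁻¹ ≤ A := by rw [hA]; linarith
  have hpx0 : 0 ≤ |pderiv j X x| := abs_nonneg _
  calc |pderiv j (c.vel u X) x|
      ≤ (M * r + M * q + |pderiv j X x| + M * (2 * M * A * r)) * a₀⁻¹ := hdiv
    _ ≤ (M * r + M * q + |pderiv j X x| + M * (2 * M * A * r)) * A :=
        mul_le_mul_of_nonneg_left hinvA (by positivity)
    _ = (M * A + 2 * M ^ 2 * A ^ 2) * r + M * A * q + A * |pderiv j X x| := by ring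
    _ ≤ 3 * M ^ 2 * A ^ 2 * r + M * A * q + A * |pderiv j X x| := by
        have hMA : 1 ≤ M * A := one_le_mul_of_one_le_of_one_le hM hA1
        have h : M * A ≤ M ^ 2 * A ^ 2 := by
          calc M * A = M * A * 1 := by ring
            _ ≤ M * A * (M * A) := mul_le_mul_of_nonneg_left hMA (by positivity)
            _ = M ^ 2 * A ^ 2 := by ring
        have h' : 0 ≤ (M ^ 2 * A ^ 2 - M * A) * r := mul_nonneg (sub_nonneg.2 h) hr0
        nlinarith

/-- **The size of `hⱼ = ∂ⱼ(ψ V)`**: `|∂ⱼ(ψV)| ≤ 5M³A² r + M²A (∑ₖ |∂ⱼ∂ₖu| + |∂ⱼX|)`.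
[folklore] -/
theorem abs_pderiv_mul_vel_le {ψ : 𝔼 → ℝ} {M a₀ : ℝ} {x : 𝔼} (hb : CoeffBoundAt c ψ M a₀ x)
    (hM : 1 ≤ M) (ha₀ : 0 < a₀) (hψ : ContDiff ℝ ∞ ψ) {u X : 𝔼 → ℝ} (hu : ContDiff ℝ ∞ u)
    (hX : ContDiff ℝ ∞ X) (j : Fin 3) :
    |pderiv j (fun y => ψ y * c.vel u X y) x| ≤
      5 * M ^ 3 * (1 + a₀⁻¹) ^ 2 * psize u X x +
        M ^ 2 * (1 + a₀⁻¹) * ((∑ k, |pderiv j (pderiv k u) x|) + |pderiv j X x|) := by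
  set A : ℝ := 1 + a₀⁻¹ with hA
  set r := psize u X x with hr
  set q := ∑ k, |pderiv j (pderiv k u) x| with hq
  have hinf : (∞ : WithTop ℕ∞) ≠ 0 := by simp
  have hM0 : 0 ≤ M := zero_le_one.trans hM
  have ha₀inv : 0 < a₀⁻¹ := inv_pos.2 ha₀
  have hA1 : 1 ≤ A := by rw [hA]; linarith
  have hA0 : 0 ≤ A := zero_le_one.trans hA1
  have hr0 : 0 ≤ r := psize_nonneg u X x
  have hq0 : 0 ≤ q := Finset.sum_nonneg fun _ _ => abs_nonneg _
  have hpx0 : 0 ≤ |pderiv j X x| := abs_nonneg _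
  have dψ : Differentiable ℝ ψ := hψ.differentiable hinf
  have dV : Differentiable ℝ (c.vel u X) := (contDiff_vel c hu hX).differentiable hinf
  have hV := abs_vel_le hb hM ha₀ u X
  have hdV := abs_pderiv_vel_le hb hM ha₀ hu hX j
  rw [pderiv_mul dψ dV]
  calc |pderiv j ψ x * c.vel u X x + ψ x * pderiv j (c.vel u X) x|
      ≤ |pderiv j ψ x| * |c.vel u X x| + |ψ x| * |pderiv j (c.vel u X) x| := by
        rw [← abs_mul, ← abs_mul]; exact abs_add_le _ _
    _ ≤ M * (2 * M * A * r) + M * (3 * M ^ 2 * A ^ 2 * r + M * A * q + A * |pderiv j X x|) :=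
        add_le_add (mul_le_mul (hb.dψ_le j) hV (abs_nonneg _) hM0)
          (mul_le_mul hb.ψ_le hdV (abs_nonneg _) hM0)
    _ = (2 * M ^ 2 * A + 3 * M ^ 3 * A ^ 2) * r + M ^ 2 * A * q + M * A * |pderiv j X x| := by
        ring
    _ ≤ 5 * M ^ 3 * A ^ 2 * r + M ^ 2 * A * (q + |pderiv j X x|) := by
        have hMA : 1 ≤ M * A := one_le_mul_of_one_le_of_one_le hM hA1
        have h1 : M ^ 2 * A ≤ M ^ 3 * A ^ 2 := by
          calc M ^ 2 * A = M ^ 2 * A * 1 := by ring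
            _ ≤ M ^ 2 * A * (M * A) := mul_le_mul_of_nonneg_left hMA (by positivity)
            _ = M ^ 3 * A ^ 2 := by ring
        have h2 : M * A ≤ M ^ 2 * A := by
          calc M * A = M * A * 1 := by ring
            _ ≤ M * A * M := mul_le_mul_of_nonneg_left hM (by positivity)
            _ = M ^ 2 * A := by ring
        have h1' : 0 ≤ (M ^ 3 * A ^ 2 - M ^ 2 * A) * r := mul_nonneg (sub_nonneg.2 h1) hr0
        have h2' : 0 ≤ (M ^ 2 * A - M * A) * |pderiv j X x| := mul_nonneg (sub_nonneg.2 h2) hpx0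
        nlinarith

/-- The lower-order expression vanishes off the support of the weight. [folklore] -/
theorem lowerOrder_eq_zero_of_notMem (c : SliceCoeff) {ψ : 𝔼 → ℝ} (u X : 𝔼 → ℝ) {x : 𝔼}
    (hx : x ∉ tsupport ψ) : c.lowerOrder ψ u X x = 0 := by
  have hψ0 : ψ x = 0 := image_eq_zero_of_notMem_tsupport hx
  have hdψ0 : ∀ i, pderiv i ψ x = 0 := fun i => by
    rw [pderiv_apply, fderiv_of_notMem_tsupport ℝ hx]; rfl
  have hprod : ∀ (f : 𝔼 → ℝ) (i : Fin 3), pderiv i (fun z => ψ z * f z) x = 0 := by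
    intro f i
    have hx' : x ∉ tsupport fun z => ψ z * f z := fun h => hx (tsupport_mul_subset_left h)
    rw [pderiv_apply, fderiv_of_notMem_tsupport ℝ hx']; rfl
  have hprod' : ∀ i, pderiv i (fun z => ψ z * c.a z * c.b i z) x = 0 := fun i => by
    have h : (fun z => ψ z * c.a z * c.b i z) = fun z => ψ z * (c.a z * c.b i z) := by
      funext z; ring
    rw [h]; exact hprod _ i
  simp only [lowerOrder, hψ0, hdψ0, hprod, hprod', zero_mul, mul_zero, Finset.sum_const_zero,
    sub_zero, add_zero]

end SliceCoeff

/-! ### Integrated bounds for a smooth compactly supported pair -/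

namespace SliceCoeff

variable {c : SliceCoeff} {ψ : 𝔼 → ℝ} {M a₀ : ℝ}

/-- The flat energy integrand is integrable for a smooth compactly supported pair. [folklore] -/
theorem integrable_flat {v Y : 𝔼 → ℝ} (hv : ContDiff ℝ ∞ v) (hY : ContDiff ℝ ∞ Y)
    (hvc : HasCompactSupport v) (hYc : HasCompactSupport Y) :
    Integrable (fun x => Y x ^ 2 + ∑ i, pderiv i v x ^ 2) := by
  refine (integrable_sq_of_cc hY.continuous hYc).add (integrable_finsetSum _ fun i _ => ?_)
  exact integrable_sq_of_cc (contDiff_pderiv hv i).continuous (hvc.fderiv_apply ℝ _)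

/-- The flat energy is nonnegative. [folklore] -/
theorem flat_nonneg (v Y : 𝔼 → ℝ) : 0 ≤ ∫ x, (Y x ^ 2 + ∑ i, pderiv i v x ^ 2) :=
  integral_nonneg fun _ => add_nonneg (sq_nonneg _) (Finset.sum_nonneg fun _ _ => sq_nonneg _)

/-- Splitting the flat energy: `∫ (Y² + ∑ (∂ᵢv)²) = ∫ Y² + ∑ᵢ ∫ (∂ᵢv)²`. [folklore] -/
theorem integral_flat_eq {v Y : 𝔼 → ℝ} (hv : ContDiff ℝ ∞ v) (hY : ContDiff ℝ ∞ Y)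
    (hvc : HasCompactSupport v) (hYc : HasCompactSupport Y) :
    ∫ x, (Y x ^ 2 + ∑ i, pderiv i v x ^ 2) = (∫ x, Y x ^ 2) + ∑ i, ∫ x, pderiv i v x ^ 2 := by
  have hi : ∀ i, Integrable (fun x => pderiv i v x ^ 2) := fun i =>
    integrable_sq_of_cc (contDiff_pderiv hv i).continuous (hvc.fderiv_apply ℝ _)
  rw [integral_add (integrable_sq_of_cc hY.continuous hYc) (integrable_finsetSum _ fun i _ => hi i),
    integral_finsetSum _ fun i _ => hi i]

/-- **Bound for the lower-order integral**: `∫ lowerOrder ψ v Y ≤ 360 M⁵A² ∫ (Y² + ∑(∂ᵢv)²)`.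
[cite: Hormander1997, §6.3 (6.3.7)] -/
theorem integral_lowerOrder_le (hψ : ContDiff ℝ ∞ ψ) (hψc : HasCompactSupport ψ) (hM : 1 ≤ M)
    (ha₀ : 0 < a₀) (hbd : ∀ x ∈ tsupport ψ, CoeffBoundAt c ψ M a₀ x) {v Y : 𝔼 → ℝ}
    (hv : ContDiff ℝ ∞ v) (hY : ContDiff ℝ ∞ Y) (hvc : HasCompactSupport v)
    (hYc : HasCompactSupport Y) :
    ∫ x, c.lowerOrder ψ v Y x ≤
      360 * M ^ 5 * (1 + a₀⁻¹) ^ 2 * ∫ x, (Y x ^ 2 + ∑ i, pderiv i v x ^ 2) := by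
  have hpt : ∀ x, c.lowerOrder ψ v Y x ≤
      360 * M ^ 5 * (1 + a₀⁻¹) ^ 2 * (Y x ^ 2 + ∑ i, pderiv i v x ^ 2) := by
    intro x
    by_cases hx : x ∈ tsupport ψ
    · have hb := hbd x hx
      exact (le_abs_self _).trans (abs_lowerOrder_le c hψ hM ha₀ hb.a₀_le hb.ψ_le hb.dψ_le
        hb.a_le hb.da_le hb.b_le hb.db_le hb.g_le hb.dg_le)
    · rw [lowerOrder_eq_zero_of_notMem c v Y hx]
      exact mul_nonneg (by positivity) (add_nonneg (sq_nonneg _)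
        (Finset.sum_nonneg fun _ _ => sq_nonneg _))
  calc ∫ x, c.lowerOrder ψ v Y x
      ≤ ∫ x, 360 * M ^ 5 * (1 + a₀⁻¹) ^ 2 * (Y x ^ 2 + ∑ i, pderiv i v x ^ 2) :=
        integral_mono (integrable_lowerOrder c hψ hψc hv hY)
          ((integrable_flat hv hY hvc hYc).const_mul _) hpt
    _ = 360 * M ^ 5 * (1 + a₀⁻¹) ^ 2 * ∫ x, (Y x ^ 2 + ∑ i, pderiv i v x ^ 2) :=
        integral_const_mul _ _

/-- **Bound for the cut-off gradient term**:
`∫ 𝔅ᵢⱼ ∂ᵢv (∂ⱼψ) V ≤ 16 M⁴A ∫ (Y² + ∑(∂ₖv)²)` (`V = vel v Y`). [folklore] -/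
theorem integral_bform_dpsi_vel_le (hψ : ContDiff ℝ ∞ ψ) (hM : 1 ≤ M)
    (ha₀ : 0 < a₀) (hbd : ∀ x ∈ tsupport ψ, CoeffBoundAt c ψ M a₀ x) {v Y : 𝔼 → ℝ}
    (hv : ContDiff ℝ ∞ v) (hY : ContDiff ℝ ∞ Y) (hvc : HasCompactSupport v)
    (hYc : HasCompactSupport Y) (i j : Fin 3) :
    ∫ x, c.bform i j x * pderiv i v x * (pderiv j ψ x * c.vel v Y x) ≤
      16 * M ^ 4 * (1 + a₀⁻¹) * ∫ x, (Y x ^ 2 + ∑ k, pderiv k v x ^ 2) := by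
  set A : ℝ := 1 + a₀⁻¹ with hA
  have hM0 : 0 ≤ M := zero_le_one.trans hM
  have hA0 : 0 ≤ A := by rw [hA]; positivity
  have hpt : ∀ x, c.bform i j x * pderiv i v x * (pderiv j ψ x * c.vel v Y x) ≤
      16 * M ^ 4 * A * (Y x ^ 2 + ∑ k, pderiv k v x ^ 2) := by
    intro x
    by_cases hx : x ∈ tsupport ψ
    · have hb := hbd x hx
      have hr0 := psize_nonneg v Y x
      have hpi : |pderiv i v x| ≤ psize v Y x :=
        (Finset.single_le_sum (fun k _ => abs_nonneg (pderiv k v x)) (Finset.mem_univ i)).trans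
          (le_add_of_nonneg_left (abs_nonneg _))
      refine (le_abs_self _).trans ?_
      calc |c.bform i j x * pderiv i v x * (pderiv j ψ x * c.vel v Y x)|
          = |c.bform i j x| * |pderiv i v x| * (|pderiv j ψ x| * |c.vel v Y x|) := by
            rw [abs_mul, abs_mul, abs_mul]
        _ ≤ 2 * M ^ 2 * psize v Y x * (M * (2 * M * A * psize v Y x)) :=
            mul_le_mul (mul_le_mul (abs_bform_le hb hM0 i j) hpi (abs_nonneg _) (by positivity))
              (mul_le_mul (hb.dψ_le j) (abs_vel_le hb hM ha₀ v Y) (abs_nonneg _) hM0)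
              (by positivity) (by positivity)
        _ = 4 * M ^ 4 * A * psize v Y x ^ 2 := by ring
        _ ≤ 4 * M ^ 4 * A * (4 * (Y x ^ 2 + ∑ k, pderiv k v x ^ 2)) :=
            mul_le_mul_of_nonneg_left (psize_sq_le v Y x) (by positivity)
        _ = 16 * M ^ 4 * A * (Y x ^ 2 + ∑ k, pderiv k v x ^ 2) := by ring
    · have h0 : pderiv j ψ x = 0 := by rw [pderiv_apply, fderiv_of_notMem_tsupport ℝ hx]; rfl
      rw [h0, zero_mul, mul_zero]
      exact mul_nonneg (by positivity) (add_nonneg (sq_nonneg _)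
        (Finset.sum_nonneg fun _ _ => sq_nonneg _))
  have hint : Integrable fun x => c.bform i j x * pderiv i v x * (pderiv j ψ x * c.vel v Y x) := by
    have hcont : Continuous fun x => c.bform i j x * pderiv i v x * (pderiv j ψ x * c.vel v Y x) :=
      ((contDiff_bform c i j).continuous.mul (contDiff_pderiv hv i).continuous).mul
        ((contDiff_pderiv hψ j).continuous.mul (contDiff_vel c hv hY).continuous)
    refine hcont.integrable_of_hasCompactSupport ?_
    exact ((hvc.fderiv_apply ℝ (stdVec i)).mul_left).mul_right
  calc ∫ x, c.bform i j x * pderiv i v x * (pderiv j ψ x * c.vel v Y x)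
      ≤ ∫ x, 16 * M ^ 4 * A * (Y x ^ 2 + ∑ k, pderiv k v x ^ 2) :=
        integral_mono hint ((integrable_flat hv hY hvc hYc).const_mul _) hpt
    _ = 16 * M ^ 4 * A * ∫ x, (Y x ^ 2 + ∑ k, pderiv k v x ^ 2) := integral_const_mul _ _

/-- **`L²` size of `hⱼ = ∂ⱼ(ψ V)`**:
`∫ (∂ⱼ(ψV))² ≤ 200 M⁶A⁴ ∫(Y² + ∑(∂ₖv)²) + 8 M⁴A² (∑ₖ ∫ (∂ⱼ∂ₖv)² + ∫ (∂ⱼY)²)`. [folklore] -/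
theorem integral_sq_pderiv_mul_vel_le (hψ : ContDiff ℝ ∞ ψ) (hψc : HasCompactSupport ψ)
    (hM : 1 ≤ M) (ha₀ : 0 < a₀) (hbd : ∀ x ∈ tsupport ψ, CoeffBoundAt c ψ M a₀ x) {v Y : 𝔼 → ℝ}
    (hv : ContDiff ℝ ∞ v) (hY : ContDiff ℝ ∞ Y) (hvc : HasCompactSupport v)
    (hYc : HasCompactSupport Y) (j : Fin 3) :
    ∫ x, pderiv j (fun y => ψ y * c.vel v Y y) x ^ 2 ≤
      200 * M ^ 6 * (1 + a₀⁻¹) ^ 4 * (∫ x, (Y x ^ 2 + ∑ k, pderiv k v x ^ 2)) +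
        8 * M ^ 4 * (1 + a₀⁻¹) ^ 2 *
          ((∑ k, ∫ x, pderiv j (pderiv k v) x ^ 2) + ∫ x, pderiv j Y x ^ 2) := by
  set A : ℝ := 1 + a₀⁻¹ with hA
  have hM0 : 0 ≤ M := zero_le_one.trans hM
  have hA0 : 0 ≤ A := by rw [hA]; positivity
  -- the pointwise bound (everywhere: off `tsupport ψ` the left-hand side vanishes)
  have hpt : ∀ x, pderiv j (fun y => ψ y * c.vel v Y y) x ^ 2 ≤
      200 * M ^ 6 * A ^ 4 * (Y x ^ 2 + ∑ k, pderiv k v x ^ 2) +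
        8 * M ^ 4 * A ^ 2 * ((∑ k, pderiv j (pderiv k v) x ^ 2) + pderiv j Y x ^ 2) := by
    intro x
    have hR0 : 0 ≤ 200 * M ^ 6 * A ^ 4 * (Y x ^ 2 + ∑ k, pderiv k v x ^ 2) +
        8 * M ^ 4 * A ^ 2 * ((∑ k, pderiv j (pderiv k v) x ^ 2) + pderiv j Y x ^ 2) := by
      positivity
    by_cases hx : x ∈ tsupport ψ
    · have hb := hbd x hx
      have h := abs_pderiv_mul_vel_le hb hM ha₀ hψ hv hY j
      set r := psize v Y x with hr
      set q := (∑ k, |pderiv j (pderiv k v) x|) + |pderiv j Y x| with hq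
      have hr0 : 0 ≤ r := psize_nonneg v Y x
      have hq0 : 0 ≤ q := add_nonneg (Finset.sum_nonneg fun _ _ => abs_nonneg _) (abs_nonneg _)
      have hr2 := psize_sq_le v Y x
      -- `q² ≤ 4 (∑ (∂ⱼ∂ₖv)² + (∂ⱼY)²)`
      have hq2 : q ^ 2 ≤ 4 * ((∑ k, pderiv j (pderiv k v) x ^ 2) + pderiv j Y x ^ 2) := by
        set p : Fin 3 → ℝ := fun k => pderiv j (pderiv k v) x with hp
        have hexp : q = |p 0| + |p 1| + |p 2| + |pderiv j Y x| := by
          rw [hq, Fin.sum_univ_three]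
        have h4 : (|p 0| + |p 1| + |p 2| + |pderiv j Y x|) ^ 2 ≤
            4 * (|p 0| ^ 2 + |p 1| ^ 2 + |p 2| ^ 2 + |pderiv j Y x| ^ 2) := by
          nlinarith [sq_nonneg (|p 0| - |p 1|), sq_nonneg (|p 0| - |p 2|),
            sq_nonneg (|p 0| - |pderiv j Y x|), sq_nonneg (|p 1| - |p 2|),
            sq_nonneg (|p 1| - |pderiv j Y x|), sq_nonneg (|p 2| - |pderiv j Y x|)]
        rw [← hexp, sq_abs, sq_abs, sq_abs, sq_abs] at h4
        simpa [Fin.sum_univ_three, hp, add_assoc] using h4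
      have hsq : pderiv j (fun y => ψ y * c.vel v Y y) x ^ 2 ≤
          (5 * M ^ 3 * A ^ 2 * r + M ^ 2 * A * q) ^ 2 := by
        rw [← sq_abs]
        exact pow_le_pow_left₀ (abs_nonneg _) h 2
      calc pderiv j (fun y => ψ y * c.vel v Y y) x ^ 2
          ≤ (5 * M ^ 3 * A ^ 2 * r + M ^ 2 * A * q) ^ 2 := hsq
        _ ≤ 2 * (5 * M ^ 3 * A ^ 2 * r) ^ 2 + 2 * (M ^ 2 * A * q) ^ 2 := by
            nlinarith [sq_nonneg (5 * M ^ 3 * A ^ 2 * r - M ^ 2 * A * q)]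
        _ = 50 * M ^ 6 * A ^ 4 * r ^ 2 + 2 * M ^ 4 * A ^ 2 * q ^ 2 := by ring
        _ ≤ 50 * M ^ 6 * A ^ 4 * (4 * (Y x ^ 2 + ∑ k, pderiv k v x ^ 2)) +
              2 * M ^ 4 * A ^ 2 * (4 * ((∑ k, pderiv j (pderiv k v) x ^ 2) + pderiv j Y x ^ 2)) :=
            add_le_add (mul_le_mul_of_nonneg_left hr2 (by positivity))
              (mul_le_mul_of_nonneg_left hq2 (by positivity))
        _ = _ := by ring
    · have hx' : x ∉ tsupport fun y => ψ y * c.vel v Y y := fun h => hx (tsupport_mul_subset_left h)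
      have h0 : pderiv j (fun y => ψ y * c.vel v Y y) x = 0 := by
        rw [pderiv_apply, fderiv_of_notMem_tsupport ℝ hx']; rfl
      rw [h0]
      simpa using hR0
  -- integrate
  have hi1 : Integrable fun x => Y x ^ 2 + ∑ k, pderiv k v x ^ 2 := integrable_flat hv hY hvc hYc
  have hi2 : ∀ k, Integrable fun x => pderiv j (pderiv k v) x ^ 2 := fun k =>
    integrable_sq_of_cc (contDiff_pderiv (contDiff_pderiv hv k) j).continuous
      ((hvc.fderiv_apply ℝ (stdVec k)).fderiv_apply ℝ (stdVec j))
  have hi3 : Integrable fun x => pderiv j Y x ^ 2 :=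
    integrable_sq_of_cc (contDiff_pderiv hY j).continuous (hYc.fderiv_apply ℝ (stdVec j))
  have hi23 : Integrable fun x => (∑ k, pderiv j (pderiv k v) x ^ 2) + pderiv j Y x ^ 2 :=
    (integrable_finsetSum _ fun k _ => hi2 k).add hi3
  have hlhs : Integrable fun x => pderiv j (fun y => ψ y * c.vel v Y y) x ^ 2 :=
    integrable_sq_of_cc (contDiff_pderiv (hψ.mul (contDiff_vel c hv hY)) j).continuous
      ((hψc.mul_right).fderiv_apply ℝ (stdVec j))
  calc ∫ x, pderiv j (fun y => ψ y * c.vel v Y y) x ^ 2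
      ≤ ∫ x, (200 * M ^ 6 * A ^ 4 * (Y x ^ 2 + ∑ k, pderiv k v x ^ 2) +
          8 * M ^ 4 * A ^ 2 * ((∑ k, pderiv j (pderiv k v) x ^ 2) + pderiv j Y x ^ 2)) :=
        integral_mono hlhs ((hi1.const_mul _).add (hi23.const_mul _)) hpt
    _ = 200 * M ^ 6 * A ^ 4 * (∫ x, (Y x ^ 2 + ∑ k, pderiv k v x ^ 2)) +
          8 * M ^ 4 * A ^ 2 * ((∑ k, ∫ x, pderiv j (pderiv k v) x ^ 2) + ∫ x, pderiv j Y x ^ 2) := by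
        rw [integral_add (hi1.const_mul _) (hi23.const_mul _), integral_const_mul,
          integral_const_mul, integral_add (integrable_finsetSum _ fun k _ => hi2 k) hi3,
          integral_finsetSum _ fun k _ => hi2 k]

end SliceCoeff

/-! ### The main estimate -/

/-- The constant of the uniform energy inequality: `C⋆ = (504 + 270 L (1 + K)) M⁵ (1 + a₀⁻¹)²`.
[folklore] -/
def cstar (M a₀ L K : ℝ) : ℝ := (504 + 270 * L * (1 + K)) * M ^ 5 * (1 + a₀⁻¹) ^ 2

namespace SliceCoeff

set_option maxHeartbeats 1600000 in
/-- **The uniform energy inequality for the regularised, cut-off frozen-time system** (Alinhac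
2009, proof of Thm. 7.11, Step 2 (c): an energy inequality "with fixed constants independent of
`ε`"): for frozen coefficients `c`, a smooth compactly supported cut-off `ψ` on whose support the
weight, the coefficients and their first derivatives are bounded by `M ≥ 1`, `a ≥ a₀ > 0`, and the
energy form `𝔅ᵢⱼ` is `L`-Lipschitz at scale `2`, for every `ε ∈ (0, 1]` and every smooth compactly
supported pair `(u, X)`, with `F₁ = J_ε(ψ · vel (J_εu) (J_εX))`, `F₂ = J_ε(ψ · divFlux (J_εu) (J_εX))`:

  `∫ epair u X F₁ F₂ ≤ C⋆ · ∫ (X² + ∑ᵢ (∂ᵢu)²)`,   `C⋆ = cstar M a₀ L K`, `K = mollifierGradMass`.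

[cite: AlinhacHPDE2009, Thm. 7.11 proof Step 2 (c)] -/
theorem integral_epair_regularised_le (c : SliceCoeff) {ψ : 𝔼 → ℝ} (hψ : ContDiff ℝ ∞ ψ)
    (hψc : HasCompactSupport ψ) {M a₀ L : ℝ} (hM : 1 ≤ M) (ha₀ : 0 < a₀) (hL : 0 ≤ L)
    (hbd : ∀ x ∈ tsupport ψ, CoeffBoundAt c ψ M a₀ x)
    (hLip : ∀ i j, ∀ x ∈ tsupport ψ, ∀ y, ‖x - y‖ < 2 →
      |c.bform i j y - c.bform i j x| ≤ L * ‖x - y‖)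
    {ε : ℝ} (hε : 0 < ε) (hε1 : ε ≤ 1) {u X : 𝔼 → ℝ} (hu : ContDiff ℝ ∞ u) (hX : ContDiff ℝ ∞ X)
    (huc : HasCompactSupport u) (hXc : HasCompactSupport X) :
    ∫ x, c.epair u X (mollify ε (fun y => ψ y * c.vel (mollify ε u) (mollify ε X) y))
        (mollify ε (fun y => ψ y * c.divFlux (mollify ε u) (mollify ε X) y)) x ≤
      cstar M a₀ L (mollifierGradMass 𝔼) * ∫ x, (X x ^ 2 + ∑ i, pderiv i u x ^ 2) := by
  -- names
  set K : ℝ := mollifierGradMass 𝔼 with hK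
  set A : ℝ := 1 + a₀⁻¹ with hA
  set ut : 𝔼 → ℝ := mollify ε u with hut
  set Xt : 𝔼 → ℝ := mollify ε X with hXt
  set V : 𝔼 → ℝ := c.vel ut Xt with hV
  set D : 𝔼 → ℝ := c.divFlux ut Xt with hD
  set gV : 𝔼 → ℝ := fun y => ψ y * V y with hgV
  set gD : 𝔼 → ℝ := fun y => ψ y * D y with hgD
  set F₁ : 𝔼 → ℝ := mollify ε gV with hF₁
  set F₂ : 𝔼 → ℝ := mollify ε gD with hF₂
  set flat : ℝ := ∫ x, (X x ^ 2 + ∑ i, pderiv i u x ^ 2) with hflat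
  set flatT : ℝ := ∫ x, (Xt x ^ 2 + ∑ i, pderiv i ut x ^ 2) with hflatT
  have hK0 : 0 ≤ K := mollifierGradMass_nonneg
  have hM0 : 0 ≤ M := zero_le_one.trans hM
  have ha₀inv : 0 < a₀⁻¹ := inv_pos.2 ha₀
  have hA1 : 1 ≤ A := by rw [hA]; linarith
  have hA0 : 0 ≤ A := zero_le_one.trans hA1
  -- smoothness and supports
  have cu : Continuous u := hu.continuous
  have cX : Continuous X := hX.continuous
  have sut : ContDiff ℝ ∞ ut := contDiff_mollify_of_continuous ε cu
  have sXt : ContDiff ℝ ∞ Xt := contDiff_mollify_of_continuous ε cX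
  have kut : HasCompactSupport ut := hasCompactSupport_mollify ε huc
  have kXt : HasCompactSupport Xt := hasCompactSupport_mollify ε hXc
  have sV : ContDiff ℝ ∞ V := contDiff_vel c sut sXt
  have sD : ContDiff ℝ ∞ D := contDiff_divFlux c sut sXt
  have sgV : ContDiff ℝ ∞ gV := hψ.mul sV
  have sgD : ContDiff ℝ ∞ gD := hψ.mul sD
  have kgV : HasCompactSupport gV := hψc.mul_right
  have kgD : HasCompactSupport gD := hψc.mul_right
  have sF₁ : ContDiff ℝ ∞ F₁ := contDiff_mollify_of_continuous ε sgV.continuous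
  have sF₂ : ContDiff ℝ ∞ F₂ := contDiff_mollify_of_continuous ε sgD.continuous
  have kdu : ∀ i, HasCompactSupport (pderiv i u) := fun i => huc.fderiv_apply ℝ (stdVec i)
  have sdu : ∀ i, ContDiff ℝ ∞ (pderiv i u) := fun i => contDiff_pderiv hu i
  -- derivative identities
  have hdut : ∀ i, pderiv i ut = mollify ε (pderiv i u) := fun i => pderiv_mollify_eq ε hu huc i
  have hdF₁ : ∀ j, pderiv j F₁ = mollify ε (pderiv j gV) := fun j => pderiv_mollify_eq ε sgV kgV j
  -- the two flat energies and their comparison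
  have hflat0 : 0 ≤ flat := flat_nonneg u X
  have hflatT0 : 0 ≤ flatT := flat_nonneg ut Xt
  have hFX : ∫ x, Xt x ^ 2 ≤ ∫ x, X x ^ 2 := integral_sq_mollify_le_cc ε cX hXc
  have hFp : ∀ i, ∫ x, pderiv i ut x ^ 2 ≤ ∫ x, pderiv i u x ^ 2 := fun i => by
    rw [hdut i]; exact integral_sq_mollify_le_cc ε (sdu i).continuous (kdu i)
  have hflatT_le : flatT ≤ flat := by
    rw [hflatT, hflat, integral_flat_eq sut sXt kut kXt, integral_flat_eq hu hX huc hXc]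
    exact add_le_add hFX (Finset.sum_le_sum fun i _ => hFp i)
  have hFX_le : ∫ x, X x ^ 2 ≤ flat := by
    rw [hflat, integral_flat_eq hu hX huc hXc]
    exact le_add_of_nonneg_right (Finset.sum_nonneg fun i _ =>
      integral_nonneg fun x => sq_nonneg (pderiv i u x))
  have hFp_le : ∀ i, ∫ x, pderiv i u x ^ 2 ≤ flat := fun i => by
    have h1 : ∫ x, pderiv i u x ^ 2 ≤ ∑ k, ∫ x, pderiv k u x ^ 2 :=
      Finset.single_le_sum (f := fun k => ∫ x, pderiv k u x ^ 2)
        (fun k _ => integral_nonneg fun x => sq_nonneg (pderiv k u x)) (Finset.mem_univ i)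
    have h2 : 0 ≤ ∫ x, X x ^ 2 := integral_nonneg fun x => sq_nonneg (X x)
    rw [hflat, integral_flat_eq hu hX huc hXc]
    linarith
  have hsumFp_le : (∑ k, ∫ x, pderiv k u x ^ 2) + ∫ x, X x ^ 2 ≤ flat := by
    rw [hflat, integral_flat_eq hu hX huc hXc, add_comm]
  -- Step 1: split the left-hand side
  have i0 : Integrable fun x => X x * F₂ x :=
    (cX.mul sF₂.continuous).integrable_of_hasCompactSupport hXc.mul_right
  have iij : ∀ i j, Integrable fun x => c.bform i j x * pderiv i u x * pderiv j F₁ x := fun i j =>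
    (((contDiff_bform c i j).continuous.mul (sdu i).continuous).mul
      (contDiff_pderiv sF₁ j).continuous).integrable_of_hasCompactSupport
        ((kdu i).mul_left.mul_right)
  have hsplit : ∫ x, c.epair u X F₁ F₂ x =
      (∫ x, X x * F₂ x) + ∑ i, ∑ j, ∫ x, c.bform i j x * pderiv i u x * pderiv j F₁ x := by
    simp only [epair_apply]
    rw [integral_add i0 (integrable_finsetSum _ fun i _ => integrable_finsetSum _ fun j _ => iij i j),
      integral_finsetSum _ fun i _ => integrable_finsetSum _ fun j _ => iij i j]
    refine congrArg _ (Finset.sum_congr rfl fun i _ => ?_)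
    rw [integral_finsetSum _ fun j _ => iij i j]
  -- Step 2: the `X`-term
  have h2 : ∫ x, X x * F₂ x = ∫ y, Xt y * gD y :=
    integral_mul_mollify_comm ε cX hXc sgD.continuous.locallyIntegrable
  -- Step 3: the `(i, j)`-terms
  set Comm : Fin 3 → Fin 3 → 𝔼 → ℝ := fun i j y =>
    mollify ε (fun z => c.bform i j z * pderiv i u z) y - c.bform i j y * mollify ε (pderiv i u) y
    with hComm
  set h : Fin 3 → 𝔼 → ℝ := fun j => pderiv j gV with hh
  have hinf : (∞ : WithTop ℕ∞) ≠ 0 := by simp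
  have hh_eq : ∀ j y, h j y = pderiv j ψ y * V y + ψ y * pderiv j V y := fun j y =>
    congrFun (pderiv_mul (hψ.differentiable hinf) (sV.differentiable hinf) j) y
  have kh : ∀ j, HasCompactSupport (h j) := fun j => kgV.fderiv_apply ℝ (stdVec j)
  have sh : ∀ j, Continuous (h j) := fun j => (contDiff_pderiv sgV j).continuous
  have h3 : ∀ i j, ∫ x, c.bform i j x * pderiv i u x * pderiv j F₁ x =
      (∫ y, c.bform i j y * pderiv i ut y * (pderiv j ψ y * V y)) +
        (∫ y, ψ y * (c.bform i j y * pderiv i ut y * pderiv j V y)) +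
          ∫ y, Comm i j y * h j y := by
    intro i j
    -- move `J_ε` to the other factor
    have step1 : ∫ x, c.bform i j x * pderiv i u x * pderiv j F₁ x =
        ∫ y, mollify ε (fun z => c.bform i j z * pderiv i u z) y * h j y := by
      rw [hdF₁ j]
      exact integral_mul_mollify_comm ε ((contDiff_bform c i j).continuous.mul (sdu i).continuous)
        (kdu i).mul_left (sh j).locallyIntegrable
    -- commutator decomposition and `J_ε ∂ᵢu = ∂ᵢ(J_ε u)`
    have step2 : ∀ y, mollify ε (fun z => c.bform i j z * pderiv i u z) y =
        c.bform i j y * pderiv i ut y + Comm i j y := by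
      intro y; rw [hdut i, hComm]; ring
    rw [step1]
    have iA : Integrable fun y => c.bform i j y * pderiv i ut y * (pderiv j ψ y * V y) :=
      (((contDiff_bform c i j).continuous.mul (contDiff_pderiv sut i).continuous).mul
        ((contDiff_pderiv hψ j).continuous.mul sV.continuous)).integrable_of_hasCompactSupport
          ((kut.fderiv_apply ℝ (stdVec i)).mul_left.mul_right)
    have iB : Integrable fun y => ψ y * (c.bform i j y * pderiv i ut y * pderiv j V y) :=
      (hψ.continuous.mul (((contDiff_bform c i j).continuous.mul
        (contDiff_pderiv sut i).continuous).mul (contDiff_pderiv sV j).continuous))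
          |>.integrable_of_hasCompactSupport hψc.mul_right
    have cComm : Continuous (Comm i j) := by
      rw [hComm]
      exact (continuous_mollify ε (((contDiff_bform c i j).continuous.mul
        (sdu i).continuous).locallyIntegrable)).sub
          ((contDiff_bform c i j).continuous.mul (continuous_mollify ε (sdu i).continuous.locallyIntegrable))
    have iC : Integrable fun y => Comm i j y * h j y :=
      (cComm.mul (sh j)).integrable_of_hasCompactSupport (kh j).mul_left
    have hpt : ∀ y, mollify ε (fun z => c.bform i j z * pderiv i u z) y * h j y =
        c.bform i j y * pderiv i ut y * (pderiv j ψ y * V y) +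
          ψ y * (c.bform i j y * pderiv i ut y * pderiv j V y) + Comm i j y * h j y := by
      intro y; rw [step2 y, hh_eq j y]; ring
    have iAB : Integrable fun y => c.bform i j y * pderiv i ut y * (pderiv j ψ y * V y) +
        ψ y * (c.bform i j y * pderiv i ut y * pderiv j V y) := iA.add iB
    simp_rw [hpt]
    rw [integral_add iAB iC, integral_add iA iB]
  -- Step 4: recombination into the weighted identity
  have h4 : (∫ y, Xt y * gD y) + ∑ i, ∑ j, ∫ y, ψ y * (c.bform i j y * pderiv i ut y * pderiv j V y) =
      ∫ y, c.lowerOrder ψ ut Xt y := by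
    rw [← integral_mul_epair_vel_divFlux_eq c hψ hψc sut sXt, ← hV, ← hD]
    have iXD : Integrable fun y => ψ y * (Xt y * D y) :=
      (hψ.continuous.mul (sXt.continuous.mul sD.continuous)).integrable_of_hasCompactSupport
        hψc.mul_right
    have iB : ∀ i j, Integrable fun y => ψ y * (c.bform i j y * pderiv i ut y * pderiv j V y) :=
      fun i j => (hψ.continuous.mul (((contDiff_bform c i j).continuous.mul
        (contDiff_pderiv sut i).continuous).mul (contDiff_pderiv sV j).continuous))
          |>.integrable_of_hasCompactSupport hψc.mul_right
    have hpt : ∀ y, ψ y * c.epair ut Xt V D y =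
        ψ y * (Xt y * D y) + ∑ i, ∑ j, ψ y * (c.bform i j y * pderiv i ut y * pderiv j V y) := by
      intro y
      rw [epair_apply, mul_add, Finset.mul_sum]
      refine congrArg _ (Finset.sum_congr rfl fun i _ => ?_)
      rw [Finset.mul_sum]
    simp_rw [hpt]
    rw [integral_add iXD (integrable_finsetSum _ fun i _ => integrable_finsetSum _ fun j _ => iB i j),
      integral_finsetSum _ fun i _ => integrable_finsetSum _ fun j _ => iB i j]
    have hXD : ∫ y, Xt y * gD y = ∫ y, ψ y * (Xt y * D y) :=
      integral_congr_ae (ae_of_all _ fun y => by rw [hgD]; ring)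
    rw [hXD]
    refine congrArg _ (Finset.sum_congr rfl fun i _ => ?_)
    rw [integral_finsetSum _ fun j _ => iB i j]
  -- Step 5: the three bounds
  have B1 : ∫ y, c.lowerOrder ψ ut Xt y ≤ 360 * M ^ 5 * A ^ 2 * flat :=
    (integral_lowerOrder_le hψ hψc hM ha₀ hbd sut sXt kut kXt).trans
      (mul_le_mul_of_nonneg_left hflatT_le (by positivity))
  have B2 : ∀ i j, ∫ y, c.bform i j y * pderiv i ut y * (pderiv j ψ y * V y) ≤
      16 * M ^ 5 * A ^ 2 * flat := by
    intro i j
    refine (integral_bform_dpsi_vel_le hψ hM ha₀ hbd sut sXt kut kXt i j).trans ?_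
    have h2 : M ^ 4 * A ≤ M ^ 5 * A ^ 2 := by
      have hMA : 1 ≤ M * A := one_le_mul_of_one_le_of_one_le hM hA1
      calc M ^ 4 * A = M ^ 4 * A * 1 := by ring
        _ ≤ M ^ 4 * A * (M * A) := mul_le_mul_of_nonneg_left hMA (by positivity)
        _ = M ^ 5 * A ^ 2 := by ring
    rw [← hA]
    calc 16 * M ^ 4 * A * flatT ≤ 16 * M ^ 4 * A * flat :=
          mul_le_mul_of_nonneg_left hflatT_le (by positivity)
      _ = 16 * flat * (M ^ 4 * A) := by ring
      _ ≤ 16 * flat * (M ^ 5 * A ^ 2) := mul_le_mul_of_nonneg_left h2 (by positivity)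
      _ = 16 * M ^ 5 * A ^ 2 * flat := by ring
  -- the commutator terms
  have B3 : ∀ i j, ∫ y, Comm i j y * h j y ≤ 30 * L * (1 + K) * M ^ 5 * A ^ 2 * flat := by
    intro i j
    set S : Set 𝔼 := tsupport ψ with hS
    have hSm : MeasurableSet S := (isClosed_tsupport ψ).measurableSet
    -- localise the commutator to `S` (outside `S` the factor `h j` vanishes)
    have hloc : ∫ y, Comm i j y * h j y = ∫ y, S.indicator (Comm i j) y * h j y := by
      refine integral_congr_ae (ae_of_all _ fun y => ?_)
      show Comm i j y * h j y = S.indicator (Comm i j) y * h j y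
      by_cases hy : y ∈ S
      · rw [Set.indicator_of_mem hy]
      · have hy' : y ∉ tsupport gV := fun hh' => hy (tsupport_mul_subset_left hh')
        have h0 : h j y = 0 := by
          show pderiv j gV y = 0
          rw [pderiv_apply, fderiv_of_notMem_tsupport ℝ hy']; rfl
        rw [h0, mul_zero, mul_zero]
    -- the localised commutator estimate
    have hLip' : ∀ x ∈ S, ∀ y, ‖x - y‖ < 2 * ε → |c.bform i j y - c.bform i j x| ≤ L * ‖x - y‖ :=
      fun x hx y hxy => hLip i j x hx y (by linarith)
    obtain ⟨hci, hcomm⟩ := integral_indicator_sq_commutator_le hε (contDiff_bform c i j).continuous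
      (sdu i).continuous (kdu i) hSm hL hLip'
    have hmem : MemLp (S.indicator (Comm i j)) 2 volume := by
      have hcont : Continuous (Comm i j) := by
        rw [hComm]
        exact (continuous_mollify ε (((contDiff_bform c i j).continuous.mul
          (sdu i).continuous).locallyIntegrable)).sub
            ((contDiff_bform c i j).continuous.mul
              (continuous_mollify ε (sdu i).continuous.locallyIntegrable))
      have hm : AEStronglyMeasurable (S.indicator (Comm i j)) volume :=
        hcont.aestronglyMeasurable.indicator hSm
      exact (memLp_two_iff_integrable_sq hm).2 hci
    -- Cauchy–Schwarz
    have hCS := integral_mul_le_sqrt_of_memLp_cc hmem (sh j) (kh j)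
    -- size of the first factor
    have hfac1 : Real.sqrt (∫ y, S.indicator (Comm i j) y ^ 2) ≤ 2 * ε * L * Real.sqrt flat := by
      calc Real.sqrt (∫ y, S.indicator (Comm i j) y ^ 2)
          ≤ Real.sqrt ((2 * ε * L) ^ 2 * ∫ y, pderiv i u y ^ 2) := Real.sqrt_le_sqrt hcomm
        _ ≤ Real.sqrt ((2 * ε * L) ^ 2 * flat) :=
            Real.sqrt_le_sqrt (mul_le_mul_of_nonneg_left (hFp_le i) (sq_nonneg _))
        _ = 2 * ε * L * Real.sqrt flat := by
            rw [Real.sqrt_mul (sq_nonneg _), Real.sqrt_sq (by positivity)]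
    -- size of the second factor: `ε² ∫ hⱼ² ≤ (15 M³A²(1+K))² flat`
    have hh2 : ∫ y, h j y ^ 2 ≤ 200 * M ^ 6 * A ^ 4 * flat +
        8 * M ^ 4 * A ^ 2 * ((ε⁻¹ * K) ^ 2 * flat) := by
      have hbase := integral_sq_pderiv_mul_vel_le hψ hψc hM ha₀ hbd sut sXt kut kXt j
      have hsec : ∀ k, ∫ x, pderiv j (pderiv k ut) x ^ 2 ≤ (ε⁻¹ * K) ^ 2 * ∫ x, pderiv k u x ^ 2 := by
        intro k
        rw [hdut k]
        exact (integral_sq_pderiv_mollify_le hε (sdu k).continuous (kdu k) j).2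
      have hsecX : ∫ x, pderiv j Xt x ^ 2 ≤ (ε⁻¹ * K) ^ 2 * ∫ x, X x ^ 2 :=
        (integral_sq_pderiv_mollify_le hε cX hXc j).2
      have hsum : (∑ k, ∫ x, pderiv j (pderiv k ut) x ^ 2) + ∫ x, pderiv j Xt x ^ 2 ≤
          (ε⁻¹ * K) ^ 2 * flat := by
        calc (∑ k, ∫ x, pderiv j (pderiv k ut) x ^ 2) + ∫ x, pderiv j Xt x ^ 2
            ≤ (∑ k, (ε⁻¹ * K) ^ 2 * ∫ x, pderiv k u x ^ 2) + (ε⁻¹ * K) ^ 2 * ∫ x, X x ^ 2 :=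
              add_le_add (Finset.sum_le_sum fun k _ => hsec k) hsecX
          _ = (ε⁻¹ * K) ^ 2 * ((∑ k, ∫ x, pderiv k u x ^ 2) + ∫ x, X x ^ 2) := by
              rw [mul_add, Finset.mul_sum]
          _ ≤ (ε⁻¹ * K) ^ 2 * flat := mul_le_mul_of_nonneg_left hsumFp_le (sq_nonneg _)
      calc ∫ y, h j y ^ 2 ≤ 200 * M ^ 6 * A ^ 4 * flatT +
            8 * M ^ 4 * A ^ 2 * ((∑ k, ∫ x, pderiv j (pderiv k ut) x ^ 2) + ∫ x, pderiv j Xt x ^ 2) :=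
            hbase
        _ ≤ 200 * M ^ 6 * A ^ 4 * flat + 8 * M ^ 4 * A ^ 2 * ((ε⁻¹ * K) ^ 2 * flat) :=
            add_le_add (mul_le_mul_of_nonneg_left hflatT_le (by positivity))
              (mul_le_mul_of_nonneg_left hsum (by positivity))
    have hh2ε : ε ^ 2 * ∫ y, h j y ^ 2 ≤ (15 * M ^ 3 * A ^ 2 * (1 + K)) ^ 2 * flat := by
      have hε0 : ε ≠ 0 := hε.ne'
      have hεinv : ε ^ 2 * (ε⁻¹ * K) ^ 2 = K ^ 2 := by field_simp
      have hε2 : ε ^ 2 ≤ 1 := pow_le_one₀ hε.le hε1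
      have hM46 : M ^ 4 * A ^ 2 ≤ M ^ 6 * A ^ 4 := by
        have hMA : 1 ≤ M * A := one_le_mul_of_one_le_of_one_le hM hA1
        calc M ^ 4 * A ^ 2 = M ^ 4 * A ^ 2 * 1 := by ring
          _ ≤ M ^ 4 * A ^ 2 * (M * A) ^ 2 :=
              mul_le_mul_of_nonneg_left (one_le_pow₀ hMA) (by positivity)
          _ = M ^ 6 * A ^ 4 := by ring
      have hKc : 200 + 8 * K ^ 2 ≤ 225 * (1 + K) ^ 2 := by
        have hr : 225 * (1 + K) ^ 2 = (200 + 8 * K ^ 2) + (25 + 450 * K + 217 * K ^ 2) := by ring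
        rw [hr]
        have : 0 ≤ 25 + 450 * K + 217 * K ^ 2 := by positivity
        linarith
      have t1 : ε ^ 2 * (200 * M ^ 6 * A ^ 4 * flat) ≤ 1 * (200 * M ^ 6 * A ^ 4 * flat) :=
        mul_le_mul_of_nonneg_right hε2 (by positivity)
      have t2 : 8 * K ^ 2 * flat * (M ^ 4 * A ^ 2) ≤ 8 * K ^ 2 * flat * (M ^ 6 * A ^ 4) :=
        mul_le_mul_of_nonneg_left hM46 (by positivity)
      have t3 : (200 + 8 * K ^ 2) * (M ^ 6 * A ^ 4 * flat) ≤
          225 * (1 + K) ^ 2 * (M ^ 6 * A ^ 4 * flat) :=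
        mul_le_mul_of_nonneg_right hKc (by positivity)
      calc ε ^ 2 * ∫ y, h j y ^ 2
          ≤ ε ^ 2 * (200 * M ^ 6 * A ^ 4 * flat + 8 * M ^ 4 * A ^ 2 * ((ε⁻¹ * K) ^ 2 * flat)) :=
            mul_le_mul_of_nonneg_left hh2 (sq_nonneg _)
        _ = ε ^ 2 * (200 * M ^ 6 * A ^ 4 * flat) +
              8 * flat * (M ^ 4 * A ^ 2) * (ε ^ 2 * (ε⁻¹ * K) ^ 2) := by ring
        _ = ε ^ 2 * (200 * M ^ 6 * A ^ 4 * flat) + 8 * K ^ 2 * flat * (M ^ 4 * A ^ 2) := by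
            rw [hεinv]; ring
        _ ≤ 1 * (200 * M ^ 6 * A ^ 4 * flat) + 8 * K ^ 2 * flat * (M ^ 6 * A ^ 4) := add_le_add t1 t2
        _ = (200 + 8 * K ^ 2) * (M ^ 6 * A ^ 4 * flat) := by ring
        _ ≤ 225 * (1 + K) ^ 2 * (M ^ 6 * A ^ 4 * flat) := t3
        _ = (15 * M ^ 3 * A ^ 2 * (1 + K)) ^ 2 * flat := by ring
    have hfac2 : ε * Real.sqrt (∫ y, h j y ^ 2) ≤ 15 * M ^ 3 * A ^ 2 * (1 + K) * Real.sqrt flat := by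
      have h0 : 0 ≤ ∫ y, h j y ^ 2 := integral_nonneg fun _ => sq_nonneg _
      calc ε * Real.sqrt (∫ y, h j y ^ 2) = Real.sqrt (ε ^ 2 * ∫ y, h j y ^ 2) := by
            rw [Real.sqrt_mul (sq_nonneg _), Real.sqrt_sq hε.le]
        _ ≤ Real.sqrt ((15 * M ^ 3 * A ^ 2 * (1 + K)) ^ 2 * flat) := Real.sqrt_le_sqrt hh2ε
        _ = 15 * M ^ 3 * A ^ 2 * (1 + K) * Real.sqrt flat := by
            rw [Real.sqrt_mul (sq_nonneg _), Real.sqrt_sq (by positivity)]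
    -- assemble the commutator bound
    have hsqrt0 : 0 ≤ Real.sqrt (∫ y, h j y ^ 2) := Real.sqrt_nonneg _
    have hM35 : M ^ 3 * A ^ 2 ≤ M ^ 5 * A ^ 2 := by
      have : M ^ 3 ≤ M ^ 5 := pow_le_pow_right₀ hM (by norm_num)
      exact mul_le_mul_of_nonneg_right this (by positivity)
    calc ∫ y, Comm i j y * h j y = ∫ y, S.indicator (Comm i j) y * h j y := hloc
      _ ≤ Real.sqrt (∫ y, S.indicator (Comm i j) y ^ 2) * Real.sqrt (∫ y, h j y ^ 2) := hCS
      _ ≤ (2 * ε * L * Real.sqrt flat) * Real.sqrt (∫ y, h j y ^ 2) :=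
          mul_le_mul_of_nonneg_right hfac1 hsqrt0
      _ = 2 * L * Real.sqrt flat * (ε * Real.sqrt (∫ y, h j y ^ 2)) := by ring
      _ ≤ 2 * L * Real.sqrt flat * (15 * M ^ 3 * A ^ 2 * (1 + K) * Real.sqrt flat) :=
          mul_le_mul_of_nonneg_left hfac2 (by positivity)
      _ = 30 * L * (1 + K) * (M ^ 3 * A ^ 2) * (Real.sqrt flat * Real.sqrt flat) := by ring
      _ = 30 * L * (1 + K) * (M ^ 3 * A ^ 2) * flat := by rw [Real.mul_self_sqrt hflat0]
      _ ≤ 30 * L * (1 + K) * (M ^ 5 * A ^ 2) * flat :=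
          mul_le_mul_of_nonneg_right (mul_le_mul_of_nonneg_left hM35 (by positivity)) hflat0
      _ = 30 * L * (1 + K) * M ^ 5 * A ^ 2 * flat := by ring
  -- Step 6: conclusion
  have hsum3 : ∀ i j, ∫ x, c.bform i j x * pderiv i u x * pderiv j F₁ x ≤
      (∫ y, ψ y * (c.bform i j y * pderiv i ut y * pderiv j V y)) +
        (16 * M ^ 5 * A ^ 2 * flat + 30 * L * (1 + K) * M ^ 5 * A ^ 2 * flat) := by
    intro i j
    rw [h3 i j]
    linarith [B2 i j, B3 i j]
  calc ∫ x, c.epair u X F₁ F₂ x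
      = (∫ x, X x * F₂ x) + ∑ i, ∑ j, ∫ x, c.bform i j x * pderiv i u x * pderiv j F₁ x := hsplit
    _ ≤ (∫ y, Xt y * gD y) + ∑ i, ∑ j, ((∫ y, ψ y * (c.bform i j y * pderiv i ut y * pderiv j V y)) +
          (16 * M ^ 5 * A ^ 2 * flat + 30 * L * (1 + K) * M ^ 5 * A ^ 2 * flat)) := by
        rw [h2]
        exact add_le_add le_rfl (Finset.sum_le_sum fun i _ => Finset.sum_le_sum fun j _ => hsum3 i j)
    _ = ((∫ y, Xt y * gD y) + ∑ i, ∑ j, ∫ y, ψ y * (c.bform i j y * pderiv i ut y * pderiv j V y)) +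
          9 * (16 * M ^ 5 * A ^ 2 * flat + 30 * L * (1 + K) * M ^ 5 * A ^ 2 * flat) := by
        simp only [Finset.sum_add_distrib, Finset.sum_const, Finset.card_univ, Fintype.card_fin,
          nsmul_eq_mul]
        push_cast
        ring
    _ = (∫ y, c.lowerOrder ψ ut Xt y) +
          9 * (16 * M ^ 5 * A ^ 2 * flat + 30 * L * (1 + K) * M ^ 5 * A ^ 2 * flat) := by rw [h4]
    _ ≤ 360 * M ^ 5 * A ^ 2 * flat +
          9 * (16 * M ^ 5 * A ^ 2 * flat + 30 * L * (1 + K) * M ^ 5 * A ^ 2 * flat) :=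
        add_le_add B1 le_rfl
    _ = cstar M a₀ L K * flat := by rw [cstar, hA]; ring

end SliceCoeff

end Literature.Analysis.PDE

end
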